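import Summits.QuantumFields.BalabanUV.Beta.EriceFlowEnclosureB12AsPrintedHistoryContagionShiftFlowZeroSemigroupGellMannLowOneLoop
import Summits.QuantumFields.BalabanUV.Beta.EriceFlowEnclosureB12AsPrintedHistoryContagionShiftFlowZeroSemigroupEnd

/-!
# Beta / EriceFlowEnclosureB12AsPrintedHistoryContagionShiftFlowZeroSemigroupGellMannLowEnd — ASYMPTOTIC FREEDOM IS CONTAGIOUS, part 58: THEOREM 2 AS TYPED ⟹ THE
# CONTINUUM RUNNING COUPLING OF [I]'s «g₀(ε, g)» HAS A VELOCITY AT ALMOST EVERY SCALE, AND THAT VELOCITY IS `−(β₀∕2)g³(1 + O(g))` — the carrier END of parts 54–57.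
# Part 50 embedded the continuum running coupling near the zero pin in the canonical continuous renormalization group `φ_s = Λf⁻¹∘(Λf + sβ₀)` of the limit flow
# `MemFlow (betaInf S.β)`; parts 55–57 gave that group a velocity at almost every scale, identified it with `β₀∕Λf′` at the running coupling, and bounded it by the one-loop
# β-function to relative precision O(g), with NO differentiability hypothesis on the limit functional.  HERE, from `B12BetaAsPrinted.Theorem2Statement` (a HYPOTHESIS — [I]
# Thm 2 p. 259 is STATED WITHOUT PROOF), `hrg`, NE4 `ScaleShiftRate`, node U2's moduli `HistLipschitz` ∕ `FadingMemory`: **`velocity_of_typedTheorem2`** — there are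
# β₀ > 0 (THE value of `betaInf S.β` at the zero history), b ∈ ]0, β₀] and, for every torus exponent m, a threshold g₂₅ > 0 such that for EVERY reference coupling
# `g′ ≤ g₂₅` carrying a Theorem-2-type family there is the Λ-function `Λf` of the continuum trajectories (`Λf g′ = 0`) with, writing `φ_s g := invFunOn Λf (Ioc 0 g′) (Λf g +
# sβ₀)` and `κ := 64C∕(3(1−θ)b)`: (orbits) **`φ_k g = gstar rows k`** for every Theorem-2-type family pinned at `g ∈ ]0, g′]` — the integer times ARE the continuum running
# coupling; (Lebesgue) Λf is differentiable at a.e. coupling of ]0, g′[ with **`|(−x³∕2)Λf′(x) − 1| ≤ κx`**; for every pin `g ∈ ]0, g′]` the running coupling `s ↦ φ_s g`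
# is differentiable at a.e. scale `s > 0`, with velocity V, `V < 0`, **`|(−2∕(β₀ φ_s(g)³))·V − 1| ≤ (3∕2)κ·φ_s g`**; (Gell-Mann–Low) at every real scale with
# `Λf g + sβ₀ > 0` the running coupling is differentiable at s IFF Λf is differentiable at `φ_s g`, and then `∂_s φ_s g = β₀∕Λf′(φ_s g)`; (asymptotic freedom of the
# generator) `(−2∕(β₀x³))·V → 1` uniformly as the running coupling `x → 0⁺`, ε–δ form.
# (β-flow team, prover 1 = recursion ∕ upper ∕ bare-coupling ∕ uniqueness side, unit `b2b-balaban-beta-bflow-p1`, gen 41; ROW AP-I·Uc × NODE U2 — carrier END of the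
# infinitesimal renormalization group, over part 57 `…GellMannLowOneLoop`, parts 55–56, part 36's `package_threshold_exists`, part 35's `relativeLambda_exists`, part 16's
# `reference_of_typedTheorem2`, part 32's `exists_valueAtZero` ∕ `rate_le_valueAtZero`, part 46's `rg_natCast_eq`)

HONEST FRAMING (page 1 of everything the β sub-cell writes): discharging `BetaPertH` makes Bałaban's UV stability UNCONDITIONAL — a
real constructive-QFT result; it is NOT the continuum limit and NOT the Clay problem.  HONEST DEPENDENCY (cell reorg 2026-08-19,
verbatim): «continuum YM on T⁴ ⇐ BetaPertH ∧ nine spine estimates (0/9 proved); BetaPertH ⇐ (D1) ∧ (D4) ∧ CAP+tail; G-an2-4 gates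
asym, D1 and NE2/3/4.»  THIS MODULE DISCHARGES NOTHING: it reads parts 54–57 on the carrier built by parts 16 ∕ 32 ∕ 35 ∕ 36 ∕ 46 from `B12BetaAsPrinted.Theorem2Statement`
(a HYPOTHESIS), `hrg`, NE4 `ScaleShiftRate` (GAPS G-t4-U2-1), node U2's `HistLipschitz` ∕ `FadingMemory` (G-t4-U2-2), all BY NAME — nothing restated.  NOTHING is asserted
about Bałaban's actual β beyond these hypotheses: whether ITS limit functional has the printed `β₀ = 11∕(3(4π)²)·…` at the zero history is Erice's (3.73)∕(3.75) (pp. 249–250)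
read for the limit — NOT PRINTED for the functional with memory ([I] p. 298); «velocity», «Gell-Mann–Low», «continuous renormalization group» are OUR READING (the group
acts on the continuum running COUPLING near the zero pin; that Bałaban's block-spin transformations embed in a continuous group is NOT claimed); `BetaPertH`; the continuum
limit of gauge fields; Clay.  [I] = T. Bałaban, Commun. Math. Phys. **109** (1987) 249–301 [Balaban1987RG1].

WHAT THIS FILE PROVES (0 sorry, 0 def): §93 **`velocity_of_typedTheorem2`**.
-/

namespace Summit.QuantumFields.BalabanUV.Beta.EriceFlowEnclosureB12AsPrintedHistoryContagionShiftFlowZeroSemigroupGellMannLowEnd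

open Finset Filter Topology Set Function MeasureTheory
open Literature.MathematicalPhysics.QuantumFieldTheory.Balaban1983to89
open Literature.MathematicalPhysics.QuantumFieldTheory.Balaban1983to89.B12BetaAsPrinted
open Literature.MathematicalPhysics.QuantumFieldTheory.Balaban1983to89.FlowStep (RGEqH HBeta)
open Literature.MathematicalPhysics.QuantumFieldTheory.Balaban1983to89.T4CouplingMatching (HistLipschitz FadingMemory ScaleShiftRate sprof)
open Literature.MathematicalPhysics.QuantumFieldTheory.Balaban1983to89.T4ContinuumCoupling (gstar)
open Literature.MathematicalPhysics.QuantumFieldTheory.Balaban1983to89.T4BetaStationary (SeqBox MemoryProfile betaInf memoryProfile_betaInf)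
open Literature.MathematicalPhysics.QuantumFieldTheory.Balaban1983to89.T4BetaFlowWellPosed (MemFlow solution)
open Summit.QuantumFields.BalabanUV.Beta.EriceFlowEnclosureB12AsPrintedHistoryContagionShiftFlowPicardEnd (reference_of_typedTheorem2)
open Summit.QuantumFields.BalabanUV.Beta.EriceFlowEnclosureB12AsPrintedHistoryContagionShiftFlowZero (exists_valueAtZero rate_le_valueAtZero)
open Summit.QuantumFields.BalabanUV.Beta.EriceFlowEnclosureB12AsPrintedHistoryContagionShiftFlowZeroOffset (package_of_le succ_le_of_reference_flow)
open Summit.QuantumFields.BalabanUV.Beta.EriceFlowEnclosureB12AsPrintedHistoryContagionShiftFlowZeroLambda (relativeLambda_exists)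
open Summit.QuantumFields.BalabanUV.Beta.EriceFlowEnclosureB12AsPrintedHistoryContagionShiftFlowZeroEnd (package_threshold_exists)
open Summit.QuantumFields.BalabanUV.Beta.EriceFlowEnclosureB12AsPrintedHistoryContagionShiftFlowZeroSemigroup (rg_natCast_eq)
open Summit.QuantumFields.BalabanUV.Beta.EriceFlowEnclosureB12AsPrintedHistoryContagionShiftFlowZeroSemigroupGellMannLow (differentiableAt_rg_iff
  hasDerivAt_rg_of_hasDerivAt_abel)
open Summit.QuantumFields.BalabanUV.Beta.EriceFlowEnclosureB12AsPrintedHistoryContagionShiftFlowZeroSemigroupGellMannLowOneLoop (dynAbel_chart_bounds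
  ae_hasDerivAt_dynAbel_oneLoop ae_velocity_oneLoop generator_asymptoticallyFree)

noncomputable section

variable {S : Setting}

/-! ## §93 Theorem 2 AS TYPED: the continuum running coupling has the one-loop velocity at almost every scale -/

/-- **THE CONTINUUM RUNNING COUPLING OF [I] THEOREM 2 HAS A VELOCITY AT ALMOST EVERY SCALE, AND IT IS `−(β₀∕2)g³(1 + O(g))` — FROM THEOREM 2 AS TYPED.**
`Theorem2Statement S hL` (a HYPOTHESIS), `hrg` on ]0, γ_u], NE4 `ScaleShiftRate c θ γ_u S.β` (c ≥ 0), `HistLipschitz Λ γ_u S.β` with `FadingMemory C θ Λ` (0 < θ < 1, C ≥ 0).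
THEN there are β₀ > 0 (THE value of `betaInf S.β` at the zero history), `b ∈ ]0, β₀]` and, for every torus exponent m, g₂₅ > 0 such that for EVERY reference coupling
`g′ ≤ g₂₅` with a Theorem-2-type family `rows′` there is `Λf : ℝ → ℝ`, `Λf g′ = 0`, strictly antitone on ]0, g′], such that with `φ_s g := invFunOn Λf (Ioc 0 g′) (Λf g + sβ₀)`
and `κ := 64C∕(3(1−θ)b)`: (orbits) **`φ_k g = gstar rows k`** for every Theorem-2-type family pinned at `g ∈ ]0, g′]`; (a.e. couplings) for a.e. `x ∈ ]0, g′[`, Λf has a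
derivative D at x with **`|(−x³∕2)D − 1| ≤ κx`**; (a.e. scales) for every `g ∈ ]0, g′]` and a.e. `s > 0` the running coupling has a velocity V at s, `V < 0`,
**`|(−2∕(β₀ φ_s(g)³))·V − 1| ≤ (3∕2)κ·φ_s g`**; (Gell-Mann–Low) whenever `0 < Λf g + sβ₀`: `s ↦ φ_s g` is differentiable at s IFF Λf is differentiable at `φ_s g`,
and if Λf has derivative D there then `∂_s φ_s g = β₀∕D`; (asymptotic freedom of the generator) ∀ ε > 0 ∃ δ > 0: every velocity V at a running coupling `φ_s g ≤ δ`
has `|(−2∕(β₀ φ_s(g)³))·V − 1| ≤ ε`. [cite: Balaban1987RG1, Thm 2 (0.31) p.259 with (0.20) p.256 and §5 p.298] -/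
theorem velocity_of_typedTheorem2 {hL : Odd S.L ∧ 1 < S.L} (h : Theorem2Statement S hL)
    {γu θ C c : ℝ} {Λ : ℕ → ℕ → ℝ} (hγu : 0 < γu)
    (hrg : ∀ P : B12.RunParams, Step.InInterval γu P.K (S.cpl P) → RGEqH P.K S.β (S.cpl P))
    (hS : ScaleShiftRate c θ γu S.β) (hL' : HistLipschitz Λ γu S.β) (hΛ : FadingMemory C θ Λ)
    (hθ0 : 0 < θ) (hθ1 : θ < 1) (hC : 0 ≤ C) (hc : 0 ≤ c) (m : ℕ) :
    ∃ β₀ b g₂₅ : ℝ, 0 < b ∧ b ≤ β₀ ∧ 0 < g₂₅ ∧ (∀ u : ℕ → ℝ, SeqBox γu u → |betaInf S.β u - β₀| ≤ C * ∑' j, θ ^ j * u j) ∧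
      ∀ (g' : ℝ) (rows' : ℕ → ℕ → ℝ), 0 < g' → g' ≤ g₂₅ →
      (∀ K, ∃ (m' : ℕ) (g₀ : ℝ), rows' K = S.cpl ⟨K, m', g₀⟩) → (∀ K, Step.InInterval γu K (rows' K)) → (∀ K, rows' K K = g') →
      ∃ Λf : ℝ → ℝ, Λf g' = 0 ∧ StrictAntiOn Λf (Ioc 0 g') ∧
        (∀ (g : ℝ) (rows : ℕ → ℕ → ℝ), 0 < g → g ≤ g' →
          (∀ K, ∃ (m' : ℕ) (g₀ : ℝ), rows K = S.cpl ⟨K, m', g₀⟩) → (∀ K, Step.InInterval γu K (rows K)) → (∀ K, rows K K = g) →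
          ∀ k : ℕ, invFunOn Λf (Ioc 0 g') (Λf g + (k : ℝ) * β₀) = gstar rows k) ∧
        (∀ᵐ x, x ∈ Ioo (0 : ℝ) g' → ∃ D : ℝ, HasDerivAt Λf D x ∧ |-(x ^ 3) / 2 * D - 1| ≤ 64 * C / (3 * (1 - θ) * b) * x) ∧
        (∀ g ∈ Ioc (0 : ℝ) g', ∀ᵐ s, s ∈ Ioi (0 : ℝ) →
          ∃ V : ℝ, HasDerivAt (fun σ : ℝ => invFunOn Λf (Ioc 0 g') (Λf g + σ * β₀)) V s ∧ V < 0 ∧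
            |-2 / (β₀ * invFunOn Λf (Ioc 0 g') (Λf g + s * β₀) ^ 3) * V - 1|
              ≤ 3 / 2 * (64 * C / (3 * (1 - θ) * b)) * invFunOn Λf (Ioc 0 g') (Λf g + s * β₀)) ∧
        (∀ g s : ℝ, 0 < Λf g + s * β₀ →
          (DifferentiableAt ℝ (fun σ : ℝ => invFunOn Λf (Ioc 0 g') (Λf g + σ * β₀)) s ↔
            DifferentiableAt ℝ Λf (invFunOn Λf (Ioc 0 g') (Λf g + s * β₀))) ∧
          ∀ D : ℝ, HasDerivAt Λf D (invFunOn Λf (Ioc 0 g') (Λf g + s * β₀)) →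
            HasDerivAt (fun σ : ℝ => invFunOn Λf (Ioc 0 g') (Λf g + σ * β₀)) (β₀ / D) s) ∧
        (∀ ε : ℝ, 0 < ε → ∃ δ > 0, ∀ g s V : ℝ, 0 < Λf g + s * β₀ → invFunOn Λf (Ioc 0 g') (Λf g + s * β₀) ≤ δ →
          HasDerivAt (fun σ : ℝ => invFunOn Λf (Ioc 0 g') (Λf g + σ * β₀)) V s →
          |-2 / (β₀ * invFunOn Λf (Ioc 0 g') (Λf g + s * β₀) ^ 3) * V - 1| ≤ ε) := by
  have h1θ : 0 < 1 - θ := by linarith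
  have hB := memoryProfile_betaInf hS hL' hΛ hθ0.le hθ1
  obtain ⟨β₀, h0⟩ := exists_valueAtZero hB hC hθ0.le hθ1 hγu
  obtain ⟨gr, b, g₂, -, t, hgr, hb, hg₂, -, htbox, htflow, hprof, hmem, -⟩ :=
    reference_of_typedTheorem2 h hγu hrg hS hL' hΛ hθ0 hθ1 hC hc m
  have h2gr : 0 < 2 * gr := by positivity
  have hbβ : b ≤ β₀ := rate_le_valueAtZero hC hθ0.le hθ1 hb h2gr h0 htbox htflow hprof
  have hβ₀ : 0 < β₀ := hb.trans_le hbβ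
  obtain ⟨e₀, he₀, hthr⟩ := package_threshold_exists (1 / gr ^ 2 + C * γu / (1 - θ) ^ 2 + (2 * C / ((1 - θ) * b)) ^ 2) hC hθ1 hb
  refine ⟨β₀, b, min e₀ (min g₂ (γu / 2)), hb, hbβ, lt_min he₀ (lt_min hg₂ (by positivity)), h0, fun g' rows' hg' hle hrow' hI' hpin' => ?_⟩
  obtain ⟨hs1, hs2, hs4, hs5⟩ := hthr g' hg' (hle.trans (min_le_left _ _))
  have hle2' : g' ≤ g₂ := hle.trans ((min_le_right _ _).trans (min_le_left _ _))
  have h2g' : 2 * g' ≤ γu := by linarith [hle.trans ((min_le_right _ _).trans (min_le_right _ _))]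
  have hγ : 0 ≤ γu := hγu.le
  obtain ⟨hbox', hflow'⟩ := hmem rows' g' hrow' hI' hpin' hle2'
  obtain ⟨Λf, hΛ0, hΛh, -, hanti, -, habel, huniq⟩ :=
    relativeLambda_exists hB hC hθ0.le hθ1 hb h2gr h0 htbox htflow hprof hg' h2g' hs1 hs2 hs4 hs5 hbox' hflow'
  -- Λf is a dynamical Abel function with comparison sequence 1∕gstar rows′², onto `[Λf g′, ∞[ = [0, ∞[`
  have hdyn : ∀ e ∈ Ioc (0 : ℝ) g', ∀ hh : ℕ → ℝ, SeqBox γu hh → MemFlow (betaInf S.β) e hh →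
      Tendsto (fun n => 1 / hh n ^ 2 - 1 / (gstar rows' n) ^ 2) atTop (𝓝 (Λf e)) := hΛh
  have honto : ∀ y : ℝ, Λf g' ≤ y → ∃ x ∈ Ioc (0 : ℝ) g', Λf x = y := by
    intro y hy
    rw [hΛ0] at hy
    obtain ⟨x, ⟨hx, hxy⟩, -⟩ := huniq y hy
    exact ⟨x, hx, hxy⟩
  have hbounds := dynAbel_chart_bounds hB hC hθ0.le hθ1 hb h2gr htbox htflow hprof hdyn h2g' hs1 hs2 hs4 hs5
  refine ⟨Λf, hΛ0, hanti, fun g rows hg hgg' hrow hI hpin k => ?_,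
    ae_hasDerivAt_dynAbel_oneLoop hB hC hθ0.le hθ1 hb h2gr htbox htflow hprof hdyn hanti h2g' hs1 hs2 hs4 hs5,
    fun g hg => ae_velocity_oneLoop hB hC hθ0.le hθ1 hb h2gr htbox htflow hprof hdyn hanti honto hβ₀ h2g' hs1 hs2 hs4 hs5 hg,
    fun g s hgs => ?_, fun ε hε => ?_⟩
  · -- the integer times are the continuum running coupling
    obtain ⟨hbox, hflow⟩ := hmem rows g hrow hI hpin (hgg'.trans hle2')
    have hgmem : g ∈ Ioc (0 : ℝ) g' := ⟨hg, hgg'⟩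
    obtain ⟨p1, p2, -, -⟩ := package_of_le hC hθ1 hb hγ hg hgg' hs1 hs2 hs4 hs5
    have hkmem : ∀ k, gstar rows k ∈ Ioc (0 : ℝ) g' := fun k =>
      ⟨(hbox k).1, (succ_le_of_reference_flow hB hC hθ0.le hθ1 hb h2gr h0 htbox htflow hprof hbox hflow p1 p2 k).2.2.trans hgg'⟩
    exact rg_natCast_eq hanti honto hβ₀.le hgmem hkmem (habel g hgmem _ hbox hflow) k
  · have hgs' : Λf g' < Λf g + s * β₀ := by rw [hΛ0]; exact hgs
    exact ⟨differentiableAt_rg_iff hanti honto hβ₀ hbounds hgs', fun D hD => hasDerivAt_rg_of_hasDerivAt_abel hanti honto hβ₀ hbounds hgs' hD⟩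
  · obtain ⟨δ, hδ, hall⟩ := generator_asymptoticallyFree hB hC hθ0.le hθ1 hb h2gr htbox htflow hprof hdyn hanti honto hβ₀ h2g' hs1 hs2 hs4 hs5 ε hε
    refine ⟨δ, hδ, fun g s V hgs hle' hV => hall g s V (by rw [hΛ0]; exact hgs) hle' hV⟩

end

end Summit.QuantumFields.BalabanUV.Beta.EriceFlowEnclosureB12AsPrintedHistoryContagionShiftFlowZeroSemigroupGellMannLowEnd
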